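import Summits.MatrixMultiplication.MatrixMultiplication.Theorems.ObstructionDescentRankMethodsBlind
import Literature.Barriers.MatrixMultiplication.LinearRankMethodBarrierProofs

/-!
# Rung R2 of the degree axis holds: item 30921 `RankMethodsBlindPastCactus` closed
(decomp-mm · lens 3 · gen 18)

`rankMethodsBlindPastCactus_holds`: the aside item 30921 of `route-MatrixMultiplication-ObstructionDescent`, by
`ObstructionDescentRankMethodsBlind.rankMethodsBlindPastCactus_of` instantiated at the tree's THEOREM
`Literature.Barriers.MatrixMultiplication.Buczynski2026_cactusBarrier_segre_holds` (Buczyński's cactus barrier for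
three-factor Segre formats, proved in `LinearRankMethodBarrierProofs.lean`).  Sorry-free; standard axioms.
[cite: Buczynski2026, Thm. 2 / Cor. 13 / §1.3; LandsbergGCT2017, §10.2.2 (p. 289)]
-/

set_option linter.dupNamespace false
set_option autoImplicit false

namespace Summit.MatrixMultiplication.MatrixMultiplication.Theorems.ObstructionDescentRankMethodsBlind

open Summit.MatrixMultiplication.MatrixMultiplication.Theses.ObstructionDescent (RankMethodsBlindPastCactus)

/-- **Item 30921 holds**: past the cactus wall `m ≥ 6n² − 4`, linear rank methods are blind on
`GL_m³·pad_m⟨n,n,n⟩`. [cite: Buczynski2026, Thm. 2 / Cor. 13 / §1.3] -/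
theorem rankMethodsBlindPastCactus_holds : RankMethodsBlindPastCactus :=
  rankMethodsBlindPastCactus_of
    (fun a b c ha hb hc hι hκ hμ p q L k hk t =>
      Literature.Barriers.MatrixMultiplication.Buczynski2026_cactusBarrier_segre_holds a b c ha hb hc hι hκ hμ
        p q L k hk t)

end Summit.MatrixMultiplication.MatrixMultiplication.Theorems.ObstructionDescentRankMethodsBlind
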